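import Literature.MathematicalPhysics.QuantumLattice.AbelianFluxSectors
import Summits.QuantumFields.QCD.Theorems.SpectralDefectExtinctionWindowExtinctionStubSectorCharpolySpin
import HarnessLib

/-!
# Sector decomposition of `Γ₅ D_W` for the product-flux field — plane waves and the intertwiner

Route SpectralDefectExtinction, crux `WindowExtinction`, line free-volume-heavy-witness (r6), stub S13
(`stub_sectorCharpoly`), helper file 2 of 3.

* the link values of Lüscher's field `V_[m]` at the tensor `(m₀₁, m₂₃) = (jL, j′L)`: `V(x,0) = V(x,2) = 1`,
  `V(x,1) = e^{2πi j x₀/L}`, `V(x,3) = e^{2πi j′ x₂/L}` (`prodFlux_link*`);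
* the plane waves `χ_k(x) = e^{2πi(k₁x₁ + k₃x₃)/L}` (`blochPhase`) and their orthogonality (`sum_blochPhase_mul`);
* the intertwiner `E` ("Bloch–sector basis", `blochE`) from `⊕_k sectorH(k)` to `Γ₅ D_W`, its inverse up to the factor `L²`
  (`blochG`, `blochE_mul_blochG`), and the entry formula
  `(Γ₅ D_W · E)_{(x,α),(ι,k)} = χ_k(x) · hopBlockEntry … α x₀ x₂ ι` (`hermitianWilsonDirac_mul_blochE_apply`).
The assembly (`E` is invertible, `charpoly` is invariant under the intertwiner, `charpoly` of a block-diagonal matrix is the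
product over the blocks) is in `…StubSectorCharpoly.lean`.
-/

noncomputable section

namespace Summit.QuantumFields.QCD.Cruxes.WindowExtinction.FreeVolumeHeavyWitness

open Matrix Complex Finset
open scoped Kronecker
open Literature.MathematicalPhysics.QuantumLattice Literature.MathematicalPhysics.QuantumFieldTheory
  Literature.Probability.LatticeModels

/-! ### The product-flux field `(m₀₁, m₂₃) = (jL, j′L)`: link values -/

/-- The flux tensor `(m₀₁, m₂₃) = (jL, j′L)` (all other `m_{μν} = 0`), written exactly as in `SectorCharpoly`. -/
def prodFluxTensor (L : ℕ) (j j' : ℤ) : Fin 4 → Fin 4 → ℤ := fun μ ν : Fin 4 =>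
  if μ = 0 ∧ ν = 1 then j * L else if μ = 1 ∧ ν = 0 then -(j * L)
  else if μ = 2 ∧ ν = 3 then j' * L else if μ = 3 ∧ ν = 2 then -(j' * L) else 0

variable {L : ℕ} [NeZero L] (j j' : ℤ)

/-- `V(x, 0) = 1` (its phase `−2πj x₁ δ_{x₀, L−1}` is a whole number of turns). -/
theorem prodFlux_link0 (x : TorusSite 4 L) : fluxSectorField L (prodFluxTensor L j j') (x, 0) = 1 := by
  have hL : (L : ℝ) ≠ 0 := Nat.cast_ne_zero.mpr (NeZero.ne L)
  show Circle.exp (fluxSectorPhase L (prodFluxTensor L j j') x 0) = 1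
  unfold fluxSectorPhase prodFluxTensor
  simp only [Fin.sum_univ_four, Fin.isValue]
  norm_num [Fin.ext_iff, Fin.lt_def, -ZMod.natCast_val]
  split_ifs
  · have h : -(2 * Real.pi / (L : ℝ) ^ 2 * ((L : ℝ) * ((j : ℝ) * (L : ℝ) * ((x 1).val : ℝ)))) =
        ((-(j * (x 1).val) : ℤ) : ℝ) * (2 * Real.pi) := by
      push_cast; field_simp
    rw [h, Circle.exp_int_mul_two_pi]
  · exact Circle.exp_zero

/-- `V(x, 2) = 1`. -/
theorem prodFlux_link2 (x : TorusSite 4 L) : fluxSectorField L (prodFluxTensor L j j') (x, 2) = 1 := by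
  have hL : (L : ℝ) ≠ 0 := Nat.cast_ne_zero.mpr (NeZero.ne L)
  show Circle.exp (fluxSectorPhase L (prodFluxTensor L j j') x 2) = 1
  unfold fluxSectorPhase prodFluxTensor
  simp only [Fin.sum_univ_four, Fin.isValue]
  norm_num [Fin.ext_iff, Fin.lt_def, -ZMod.natCast_val]
  split_ifs
  · have h : -(2 * Real.pi / (L : ℝ) ^ 2 * ((L : ℝ) * ((j' : ℝ) * (L : ℝ) * ((x 3).val : ℝ)))) =
        ((-(j' * (x 3).val) : ℤ) : ℝ) * (2 * Real.pi) := by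
      push_cast; field_simp
    rw [h, Circle.exp_int_mul_two_pi]
  · exact Circle.exp_zero

/-- `V(x, 1) = e^{2πi j x₀/L}`. -/
theorem prodFlux_link1 (x : TorusSite 4 L) :
    ((fluxSectorField L (prodFluxTensor L j j') (x, 1) : Circle) : ℂ) =
      Complex.exp (((2 * Real.pi * j * (x 0).val / L : ℝ) : ℂ) * I) := by
  have hL : (L : ℝ) ≠ 0 := Nat.cast_ne_zero.mpr (NeZero.ne L)
  show (Circle.exp (fluxSectorPhase L (prodFluxTensor L j j') x 1) : ℂ) = _
  rw [Circle.coe_exp]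
  congr 3
  unfold fluxSectorPhase prodFluxTensor
  simp only [Fin.sum_univ_four, Fin.isValue]
  norm_num [Fin.ext_iff, Fin.lt_def, -ZMod.natCast_val]
  field_simp

/-- `V(x, 3) = e^{2πi j′ x₂/L}`. -/
theorem prodFlux_link3 (x : TorusSite 4 L) :
    ((fluxSectorField L (prodFluxTensor L j j') (x, 3) : Circle) : ℂ) =
      Complex.exp (((2 * Real.pi * j' * (x 2).val / L : ℝ) : ℂ) * I) := by
  have hL : (L : ℝ) ≠ 0 := Nat.cast_ne_zero.mpr (NeZero.ne L)
  show (Circle.exp (fluxSectorPhase L (prodFluxTensor L j j') x 3) : ℂ) = _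
  rw [Circle.coe_exp]
  congr 3
  unfold fluxSectorPhase prodFluxTensor
  simp only [Fin.sum_univ_four, Fin.isValue]
  norm_num [Fin.ext_iff, Fin.lt_def, -ZMod.natCast_val]
  field_simp

/-- `V(x − 1̂, 1)⁻¹ = e^{−2πi j x₀/L}` (the field is `x₁`-independent). -/
theorem prodFlux_link1_inv (x : TorusSite 4 L) :
    (((fluxSectorField L (prodFluxTensor L j j') (x - Pi.single 1 1, 1))⁻¹ : Circle) : ℂ) =
      Complex.exp (-(((2 * Real.pi * j * (x 0).val / L : ℝ) : ℂ) * I)) := by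
  rw [Circle.coe_inv, prodFlux_link1, ← Complex.exp_neg]
  simp

/-- `V(x − 3̂, 3)⁻¹ = e^{−2πi j′ x₂/L}`. -/
theorem prodFlux_link3_inv (x : TorusSite 4 L) :
    (((fluxSectorField L (prodFluxTensor L j j') (x - Pi.single 3 1, 3))⁻¹ : Circle) : ℂ) =
      Complex.exp (-(((2 * Real.pi * j' * (x 2).val / L : ℝ) : ℂ) * I)) := by
  rw [Circle.coe_inv, prodFlux_link3, ← Complex.exp_neg]
  simp

/-- `V(x − 0̂, 0)⁻¹ = 1`. -/
theorem prodFlux_link0_inv (x : TorusSite 4 L) :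
    (((fluxSectorField L (prodFluxTensor L j j') (x - Pi.single 0 1, 0))⁻¹ : Circle) : ℂ) = 1 := by
  rw [prodFlux_link0, inv_one, Circle.coe_one]

/-- `V(x − 2̂, 2)⁻¹ = 1`. -/
theorem prodFlux_link2_inv (x : TorusSite 4 L) :
    (((fluxSectorField L (prodFluxTensor L j j') (x - Pi.single 2 1, 2))⁻¹ : Circle) : ℂ) = 1 := by
  rw [prodFlux_link2, inv_one, Circle.coe_one]

/-! ### Plane waves in `x₁, x₃` -/

/-- The plane wave `χ_k(x) = e^{2πi(k₁x₁ + k₃x₃)/L}` (`k = (k₁, k₃)`), through Mathlib's standard additive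
character of `ZMod L`. -/
def blochPhase (L : ℕ) [NeZero L] (k : ZMod L × ZMod L) (x : TorusSite 4 L) : ℂ :=
  ZMod.stdAddChar (k.1 * x 1 + k.2 * x 3)

omit [NeZero L] in
/-- Coordinates of the shifted site `x + μ̂`. -/
theorem prodFlux_shift_apply (x : TorusSite 4 L) (μ ν : Fin 4) :
    Literature.MathematicalPhysics.QuantumFieldTheory.Site.shift x μ ν = x ν + if ν = μ then 1 else 0 := by
  simp [Literature.MathematicalPhysics.QuantumFieldTheory.Site.shift, Pi.single_apply]

omit [NeZero L] in
/-- Coordinates of `x − μ̂`. -/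
theorem prodFlux_unshift_apply (x : TorusSite 4 L) (μ ν : Fin 4) :
    (x - Pi.single μ (1 : ZMod L) : TorusSite 4 L) ν = x ν - if ν = μ then 1 else 0 := by
  simp [Pi.single_apply]

/-- `χ_k(x + 0̂) = χ_k(x)`. -/
theorem blochPhase_shift0 (k : ZMod L × ZMod L) (x : TorusSite 4 L) :
    blochPhase L k (Literature.MathematicalPhysics.QuantumFieldTheory.Site.shift x 0) = blochPhase L k x := by
  simp [blochPhase, prodFlux_shift_apply]

/-- `χ_k(x + 2̂) = χ_k(x)`. -/
theorem blochPhase_shift2 (k : ZMod L × ZMod L) (x : TorusSite 4 L) :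
    blochPhase L k (Literature.MathematicalPhysics.QuantumFieldTheory.Site.shift x 2) = blochPhase L k x := by
  simp [blochPhase, prodFlux_shift_apply]

/-- `χ_k(x + 1̂) = e^{2πik₁/L} χ_k(x)`. -/
theorem blochPhase_shift1 (k : ZMod L × ZMod L) (x : TorusSite 4 L) :
    blochPhase L k (Literature.MathematicalPhysics.QuantumFieldTheory.Site.shift x 1) = ZMod.stdAddChar k.1 * blochPhase L k x := by
  simp only [blochPhase, prodFlux_shift_apply, ← AddChar.map_add_eq_mul]
  congr 1
  simp
  ring

/-- `χ_k(x + 3̂) = e^{2πik₃/L} χ_k(x)`. -/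
theorem blochPhase_shift3 (k : ZMod L × ZMod L) (x : TorusSite 4 L) :
    blochPhase L k (Literature.MathematicalPhysics.QuantumFieldTheory.Site.shift x 3) = ZMod.stdAddChar k.2 * blochPhase L k x := by
  simp only [blochPhase, prodFlux_shift_apply, ← AddChar.map_add_eq_mul]
  congr 1
  simp
  ring

/-- `χ_k(x − 0̂) = χ_k(x)`. -/
theorem blochPhase_unshift0 (k : ZMod L × ZMod L) (x : TorusSite 4 L) :
    blochPhase L k (x - Pi.single 0 1) = blochPhase L k x := by
  simp [blochPhase]

/-- `χ_k(x − 2̂) = χ_k(x)`. -/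
theorem blochPhase_unshift2 (k : ZMod L × ZMod L) (x : TorusSite 4 L) :
    blochPhase L k (x - Pi.single 2 1) = blochPhase L k x := by
  simp [blochPhase]

/-- `χ_k(x − 1̂) = e^{−2πik₁/L} χ_k(x)`. -/
theorem blochPhase_unshift1 (k : ZMod L × ZMod L) (x : TorusSite 4 L) :
    blochPhase L k (x - Pi.single 1 1) = ZMod.stdAddChar (-k.1) * blochPhase L k x := by
  simp only [blochPhase, prodFlux_unshift_apply, ← AddChar.map_add_eq_mul]
  congr 1
  simp
  ring

/-- `χ_k(x − 3̂) = e^{−2πik₃/L} χ_k(x)`. -/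
theorem blochPhase_unshift3 (k : ZMod L × ZMod L) (x : TorusSite 4 L) :
    blochPhase L k (x - Pi.single 3 1) = ZMod.stdAddChar (-k.2) * blochPhase L k x := by
  simp only [blochPhase, prodFlux_unshift_apply, ← AddChar.map_add_eq_mul]
  congr 1
  simp
  ring

/-- Orthogonality of the plane waves: `Σ_k χ_k(x) χ_{−k}(y) = L² [x₁ = y₁][x₃ = y₃]`. -/
theorem sum_blochPhase_mul (x y : TorusSite 4 L) :
    ∑ k : ZMod L × ZMod L, blochPhase L k x * blochPhase L (-k) y =
      if x 1 = y 1 ∧ x 3 = y 3 then ((L : ℂ) ^ 2) else 0 := by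
  have hψ := ZMod.isPrimitive_stdAddChar L
  have key : ∀ k : ZMod L × ZMod L, blochPhase L k x * blochPhase L (-k) y =
      ZMod.stdAddChar (k.1 * (x 1 - y 1)) * ZMod.stdAddChar (k.2 * (x 3 - y 3)) := by
    intro k
    simp only [blochPhase, Prod.fst_neg, Prod.snd_neg, ← AddChar.map_add_eq_mul]
    congr 1
    ring
  simp_rw [key]
  rw [Fintype.sum_prod_type]
  dsimp only
  rw [← Finset.sum_mul_sum, AddChar.sum_mulShift _ hψ, AddChar.sum_mulShift _ hψ, ZMod.card]
  by_cases h1 : x 1 = y 1 <;> by_cases h3 : x 3 = y 3 <;> simp [h1, h3, sub_eq_zero, sq]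

/-- The key phase identity in plane `(0,1)`: `V(x,1) · e^{2πik₁/L} = e^{iΦ₁(x₀)} = cos Φ₁ + i sin Φ₁`,
`Φ₁ = ringPhase L j k₁ x₀`. -/
theorem prodFlux_linkPhase_fwd (j : ℤ) (k : ZMod L) (x0 : ZMod L) :
    Complex.exp (((2 * Real.pi * j * x0.val / L : ℝ) : ℂ) * I) * ZMod.stdAddChar k =
      (Real.cos (ringPhase L j k x0) : ℂ) + (Real.sin (ringPhase L j k x0) : ℂ) * I := by
  rw [ZMod.stdAddChar_apply, ZMod.toCircle_apply, ← Complex.exp_add]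
  have h : (((2 * Real.pi * j * x0.val / L : ℝ) : ℂ) * I + 2 * Real.pi * I * k.val / L) =
      ((ringPhase L j k x0 : ℝ) : ℂ) * I := by
    unfold ringPhase; push_cast; ring
  rw [h, Complex.exp_mul_I, ← Complex.ofReal_cos, ← Complex.ofReal_sin]

/-- The conjugate phase identity: `V(x,1)⁻¹ · e^{−2πik₁/L} = cos Φ₁ − i sin Φ₁`. -/
theorem prodFlux_linkPhase_bwd (j : ℤ) (k : ZMod L) (x0 : ZMod L) :
    Complex.exp (-(((2 * Real.pi * j * x0.val / L : ℝ) : ℂ) * I)) * ZMod.stdAddChar (-k) =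
      (Real.cos (ringPhase L j k x0) : ℂ) - (Real.sin (ringPhase L j k x0) : ℂ) * I := by
  rw [AddChar.map_neg_eq_inv, ZMod.stdAddChar_apply, ZMod.toCircle_apply, ← Complex.exp_neg, ← Complex.exp_add]
  have h : (-(((2 * Real.pi * j * x0.val / L : ℝ) : ℂ) * I) + -(2 * Real.pi * I * k.val / L)) =
      ((-ringPhase L j k x0 : ℝ) : ℂ) * I := by
    unfold ringPhase; push_cast; ring
  rw [h, Complex.exp_mul_I, ← Complex.ofReal_cos, ← Complex.ofReal_sin, Real.cos_neg, Real.sin_neg]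
  push_cast
  ring

/-! ### The intertwiner ("Bloch–sector basis") -/

/-- Site part of the basis vector `(ι, k)`: `[x₀ = x₀(ι)][x₂ = x₂(ι)] χ_k(x)`. -/
def siteE (L : ℕ) [NeZero L] (x : TorusSite 4 L) (c : SectorIdx L × (ZMod L × ZMod L)) : ℂ :=
  (if x 0 = sectorPosB c.1 then 1 else 0) * (if x 2 = sectorPosA c.1 then 1 else 0) * blochPhase L c.2 x

/-- **The intertwiner `E`.**  Column `(ι, k)` is the fermion vector `(x, ·, α) ↦ [α = spin ι][x₀ = x₀(ι)][x₂ = x₂(ι)] χ_k(x)`: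
the plane wave `k` in `x₁, x₃` times the point mass at `(x₀(ι), x₂(ι))` times the chiral spinor `spin ι`. -/
def blochE (L : ℕ) [NeZero L] :
    Matrix (TorusSite 4 L × Fin 1 × Fin 4) (SectorIdx L × (ZMod L × ZMod L)) ℂ :=
  Matrix.of fun p c => (if p.2.2 = sectorSpin c.1 then 1 else 0) * siteE L p.1 c

/-- The un-normalised inverse `G = L² E⁻¹ = Eᴴ` (conjugate plane waves). -/
def blochG (L : ℕ) [NeZero L] :
    Matrix (SectorIdx L × (ZMod L × ZMod L)) (TorusSite 4 L × Fin 1 × Fin 4) ℂ :=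
  Matrix.of fun c p => (if sectorSpin c.1 = p.2.2 then 1 else 0) *
    ((if sectorPosB c.1 = p.1 0 then 1 else 0) * (if sectorPosA c.1 = p.1 2 then 1 else 0) * blochPhase L (-c.2) p.1)

omit [NeZero L] in
/-- Two sites of the four-torus agree iff their four coordinates agree. -/
theorem prodFlux_torusSite_eq_iff (x y : TorusSite 4 L) : x = y ↔ x 0 = y 0 ∧ x 1 = y 1 ∧ x 2 = y 2 ∧ x 3 = y 3 :=
  ⟨fun h => by subst h; exact ⟨rfl, rfl, rfl, rfl⟩,
    fun ⟨h0, h1, h2, h3⟩ => funext fun i => by fin_cases i <;> assumption⟩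

/-- `E G = L² · 1` (orthogonality of the plane waves; the sector part of `E` is a bijection of labels). -/
theorem blochE_mul_blochG :
    blochE L * blochG L = ((L : ℂ) ^ 2) • (1 : Matrix (TorusSite 4 L × Fin 1 × Fin 4) _ ℂ) := by
  ext ⟨x, a, α⟩ ⟨y, b, β⟩
  obtain rfl : a = b := Subsingleton.elim a b
  rw [Matrix.mul_apply, Fintype.sum_prod_type, Finset.sum_eq_single (toSectorIdx α (x 2) (x 0))]
  · simp only [blochE, blochG, siteE, Matrix.of_apply, sectorSpin_toSectorIdx, sectorPosA_toSectorIdx,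
      sectorPosB_toSectorIdx, if_true, one_mul, Matrix.smul_apply, Matrix.one_apply, Prod.mk.injEq,
      smul_eq_mul, true_and, prodFlux_torusSite_eq_iff]
    have h : ∀ k : ZMod L × ZMod L, blochPhase L k x *
        ((if α = β then (1 : ℂ) else 0) *
          ((if x 0 = y 0 then (1 : ℂ) else 0) * (if x 2 = y 2 then (1 : ℂ) else 0) * blochPhase L (-k) y)) =
        ((if α = β then (1 : ℂ) else 0) * ((if x 0 = y 0 then (1 : ℂ) else 0) * (if x 2 = y 2 then (1 : ℂ) else 0))) *
          (blochPhase L k x * blochPhase L (-k) y) := fun k => by ring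
    simp_rw [h]
    rw [← Finset.mul_sum, sum_blochPhase_mul]
    by_cases hαβ : α = β <;> by_cases h0 : x 0 = y 0 <;> by_cases h1 : x 1 = y 1 <;>
      by_cases h2 : x 2 = y 2 <;> by_cases h3 : x 3 = y 3 <;> simp [hαβ, h0, h1, h2, h3]
  · intro ι _ hι
    apply Finset.sum_eq_zero
    intro k _
    have hne : ¬(α = sectorSpin ι ∧ x 0 = sectorPosB ι ∧ x 2 = sectorPosA ι) := by
      rintro ⟨h1, h2, h3⟩
      apply hι
      rw [← toSectorIdx_sectorSpin ι, ← h1, ← h2, ← h3]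
    simp only [blochE, siteE, Matrix.of_apply]
    by_cases h1 : α = sectorSpin ι <;> by_cases h2 : x 0 = sectorPosB ι <;>
      by_cases h3 : x 2 = sectorPosA ι <;> simp_all
  · intro h
    exact absurd (Finset.mem_univ _) h

/-! ### The Hermitian Wilson–Dirac operator applied to the basis -/

omit [NeZero L] in
/-- `Γ₅` lifted to the fermion space is the diagonal matrix of chiral signs. -/
theorem prodFlux_spinorLift_gammaFive :
    (spinorLift gammaFive : Matrix (TorusSite 4 L × Fin 1 × Fin 4) (TorusSite 4 L × Fin 1 × Fin 4) ℂ) =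
      Matrix.diagonal fun p => chiralSign p.2.2 := by
  ext ⟨x, a, α⟩ ⟨y, b, β⟩
  simp only [spinorLift, Matrix.kroneckerMap_apply, gammaFive_eq_diagonal, Matrix.diagonal_apply,
    Matrix.one_apply, Prod.mk.injEq, chiralSign]
  by_cases hx : x = y <;> by_cases hab : a = b <;> by_cases hαβ : α = β <;> simp [hx, hab, hαβ]

/-- A sum over fermion indices against a site delta. -/
theorem prodFlux_sum_fermionIdx_ite {N : ℕ} (t : TorusSite 4 L) (f : TorusSite 4 L × Fin N × Fin 4 → ℂ) :
    ∑ q : TorusSite 4 L × Fin N × Fin 4, (if q.1 = t then f q else 0) = ∑ s : Fin N × Fin 4, f (t, s) := by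
  rw [Fintype.sum_prod_type, Finset.sum_eq_single t]
  · simp
  · intro y _ hy
    simp [hy]
  · intro h
    exact absurd (Finset.mem_univ _) h

/-- **Row `(x, a, α)` of `D_W · M`** for any matrix `M` on the fermion space: the mass term plus, for each
direction, the forward hop (`−½ (r − γ_μ) ρ(U(x,μ))`, column site `x + μ̂`) and the backward hop
(`−½ (r + γ_μ) ρ(U(x−μ̂,μ))⁻¹`, column site `x − μ̂`). -/
theorem prodFlux_wilsonDirac_mul_apply {N : ℕ} {G : Type*} [Group G] (ρ : G →* Matrix (Fin N) (Fin N) ℂ)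
    (U : GaugeConfig 4 L G) (m r : ℝ) {C : Type*} (M : Matrix (TorusSite 4 L × Fin N × Fin 4) C ℂ)
    (x : TorusSite 4 L) (a : Fin N) (α : Fin 4) (c : C) :
    (wilsonDirac ρ U m r * M) (x, a, α) c =
      ((m + 4 * r : ℝ) : ℂ) * M (x, a, α) c -
        (1 / 2 : ℂ) * ∑ μ : Fin 4, ∑ s : Fin N × Fin 4,
          (((r : ℂ) • (1 : Matrix (Fin 4) (Fin 4) ℂ) - euclideanGamma μ) α s.2 * ρ (U (x, μ)) a s.1 *
              M (Literature.MathematicalPhysics.QuantumFieldTheory.Site.shift x μ, s) c +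
            ((r : ℂ) • (1 : Matrix (Fin 4) (Fin 4) ℂ) + euclideanGamma μ) α s.2 *
                ρ (U (x - Pi.single μ 1, μ))⁻¹ a s.1 * M (x - Pi.single μ 1, s) c) := by
  simp only [Matrix.mul_apply, wilsonDirac, Matrix.of_apply, sub_mul, Finset.sum_sub_distrib, ite_mul,
    zero_mul, Finset.sum_ite_eq, Finset.mem_univ, if_true]
  congr 1
  simp_rw [mul_assoc (1 / 2 : ℂ), Finset.sum_mul]
  rw [← Finset.mul_sum]
  conv_lhs => rw [Finset.sum_comm]
  congr 1
  refine Finset.sum_congr rfl fun μ _ => ?_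
  simp only [add_mul, Finset.sum_add_distrib, ite_mul, zero_mul]
  simp_rw [eq_shift_iff x]
  rw [prodFlux_sum_fermionIdx_ite, prodFlux_sum_fermionIdx_ite, ← Finset.sum_add_distrib]

/-- Entries of the defining representation of `U(1)`: `u1Rep z i i' = z`. -/
theorem prodFlux_u1Rep_entry : ∀ (z : Circle) (i i' : Fin 1), u1Rep z i i' = (z : ℂ) := by
  intro z i i'
  obtain rfl : i = i' := Subsingleton.elim _ _
  rw [u1Rep_apply, Matrix.scalar_apply, Matrix.diagonal_apply_eq]

/-- The spin–colour sum of one hop against the basis `E`: only the spinor `spin ι` contributes. -/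
theorem sum_spin_blochE (S : Matrix (Fin 4) (Fin 4) ℂ) (z : Circle) (α : Fin 4) (a : Fin 1) (y : TorusSite 4 L)
    (c : SectorIdx L × (ZMod L × ZMod L)) :
    ∑ s : Fin 1 × Fin 4, S α s.2 * u1Rep z a s.1 * blochE L (y, s) c =
      S α (sectorSpin c.1) * (z : ℂ) * siteE L y c := by
  rw [Fintype.sum_prod_type, Fin.sum_univ_one]
  simp only [prodFlux_u1Rep_entry, blochE, Matrix.of_apply]
  rw [Finset.sum_eq_single (sectorSpin c.1)]
  · simp
  · intro β _ hβ
    simp [hβ]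
  · intro h
    exact absurd (Finset.mem_univ _) h

/-- **`Γ₅ D_W` on the Bloch–sector basis.**  Entry `((x, a, α), (ι, k))` of `Γ₅ D_W(V_[(jL,j′L)], m₀, 1) · E` is the
plane wave `χ_k(x)` times the hopping-form sector block entry `hopBlockEntry L j j′ k₁ k₃ m₀ α x₀ x₂ ι`
(so that, by `hopBlockEntry_eq_sectorH`, `Γ₅ D_W · E = E · ⊕_k sectorH(k)`). -/
theorem hermitianWilsonDirac_mul_blochE_apply (m₀ : ℝ) (x : TorusSite 4 L) (a : Fin 1) (α : Fin 4)
    (c : SectorIdx L × (ZMod L × ZMod L)) :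
    (spinorLift gammaFive * wilsonDirac u1Rep (fluxSectorField L (prodFluxTensor L j j')) m₀ 1 * blochE L :
        Matrix (TorusSite 4 L × Fin 1 × Fin 4) (SectorIdx L × (ZMod L × ZMod L)) ℂ) (x, a, α) c =
      blochPhase L c.2 x * hopBlockEntry L j j' c.2.1 c.2.2 m₀ α (x 0) (x 2) c.1 := by
  rw [Matrix.mul_assoc, prodFlux_spinorLift_gammaFive, Matrix.diagonal_mul, prodFlux_wilsonDirac_mul_apply]
  simp only [Fin.sum_univ_four, Fin.isValue, Finset.sum_add_distrib, sum_spin_blochE]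
  rw [prodFlux_link0, prodFlux_link2, prodFlux_link0_inv, prodFlux_link2_inv, prodFlux_link1, prodFlux_link3,
    prodFlux_link1_inv, prodFlux_link3_inv]
  unfold hopBlockEntry hopFwd hopBwd
  rw [← prodFlux_linkPhase_fwd j c.2.1 (x 0), ← prodFlux_linkPhase_bwd j c.2.1 (x 0), ← prodFlux_linkPhase_fwd j' c.2.2 (x 2),
    ← prodFlux_linkPhase_bwd j' c.2.2 (x 2)]
  simp only [siteE, blochE, Matrix.of_apply, prodFlux_shift_apply, prodFlux_unshift_apply, blochPhase_shift0,
    blochPhase_shift1, blochPhase_shift2, blochPhase_shift3, blochPhase_unshift0, blochPhase_unshift1,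
    blochPhase_unshift2, blochPhase_unshift3, Circle.coe_one, Complex.ofReal_one, one_smul, Matrix.one_apply, if_true]
  push_cast
  simp only [add_zero, sub_zero, mul_one]
  ring

end Summit.QuantumFields.QCD.Cruxes.WindowExtinction.FreeVolumeHeavyWitness

end
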